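import Summits.CriticalPhenomena.CardyFormulaZ2.Theses.CardySelfRefinement
import Summits.CriticalPhenomena.CardyFormulaZ2.Theorems.CardySelfRefinementLagHandOffDiscretisable
import Summits.CriticalPhenomena.CardyFormulaZ2.Theorems.LagHandOff.Negative.Structure
import Summits.CriticalPhenomena.CardyFormulaZ2.Theorems.CardyRotToConfR2SymmetryUpgradeFatSurgeryWitness
import Summits.CriticalPhenomena.CardyFormulaZ2.Theorems.CardyRotToConfR2SymmetryUpgradeFatDomain
import Summits.CriticalPhenomena.CardyFormulaZ2.Theorems.CardyRotToConfR2SymmetryUpgradeFatSurgeryChordal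
import Summits.CriticalPhenomena.CardyFormulaZ2.Theorems.CardyRotToConfR2SymmetryUpgradeFatSurgerySimilarity
import Summits.CriticalPhenomena.CardyFormulaZ2.Theorems.CardyRotToConfR2SymmetryUpgradeFatSurgeryLocal
import Summits.CriticalPhenomena.CardyFormulaZ2.Theorems.CardyRotToConfR2SymmetryUpgradeFatSurgeryTI
import Summits.CriticalPhenomena.CardyFormulaZ2.Theorems.CardyRotToConfR2SymmetryUpgradeMarkovCore
import Summits.CriticalPhenomena.CardyFormulaZ2.Theorems.CardyRotToConfR2SymmetryUpgradeNoTracedLine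
import Summits.CriticalPhenomena.CardyFormulaZ2.Theorems.CardyRotToConfR2SymmetryUpgradeSleNoEarlyTarget
import Summits.CriticalPhenomena.CardyFormulaZ2.Theorems.CardyRotToConfR2SymmetryUpgradeSleRangeNull
import Summits.CriticalPhenomena.CardyFormulaZ2.Theorems.CardyRotToConfR2SymmetryUpgradeNonTracing
import Literature.Probability.RandomPlanarGeometry.SLEUniquenessInLaw
import Literature.Probability.RandomPlanarGeometry.SLEExistenceNeEightHolds
import Literature.Probability.RandomPlanarGeometry.SLEDomainMarkov
import Literature.Probability.RandomPlanarGeometry.SLESixHullLocalityNbhdProved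
import Literature.Probability.RandomPlanarGeometry.SLESixSplittingReduction
import Literature.Probability.RandomPlanarGeometry.SLESixMoebiusLocalityProofs
import Literature.Probability.RandomPlanarGeometry.ConformalRestrictionCovariance
import Literature.Probability.RandomPlanarGeometry.ConformalRestrictionProofs
import Literature.Probability.RandomPlanarGeometry.CaratheodoryHalfPlaneProofs
import Literature.Probability.RandomPlanarGeometry.LocalMartingaleProofs
import Literature.Topology.PlaneTopology.OsgoodArc
import Mathlib.MeasureTheory.Measure.HasOuterApproxClosed
import HarnessLib

/-!
# `SymmetryUpgradeR` (route `CardySelfRefinement`, stmt-CriticalPhenomena-17239): load-bearing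
# analysis of the repaired symmetry upgrade — clause (iv) carries everything, clause (iii) nothing

Negative lemmas of the standing adversary (refuter `cdisprove`, cycle 1) for the crux

  `SymmetryUpgradeR : ∀ P, IsLocalMarkovChordalFamily P → (ii) no-tracing → (iii) interfaces
     eventually a.e.-measurable → (iv) P is the sequential scaling limit of the bond-ℤ² interfaces
     along ONE mesh sequence, for every Dobrushin domain and every admissible discretisation family
     → ∀ D E, ZdDiscretisationFamily D E → IsSLELaw 6 D (P D)`.

What is proved (nothing of the route is asserted positively; nothing is refuted):

* `clauseIII_holds` — hypothesis (iii) is a THEOREM (the interface at positive mesh reads finitely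
  many edges; `LagHandOff.Negative.lagHandOff_clause_i`): it is decoration, any proof may discharge
  it, no disproof can exploit it.
* `symmetryUpgradeR_false_without_clauseIV` — with clause (iv) DELETED (clauses (i)–(iii) and the
  discretisability guard of the conclusion kept verbatim) the statement is FALSE: the chordal SLE₆
  family (Rohde–Schramm existence; admissible by the tree's locality / Markov / covariance theorems,
  `isLocalMarkovChordalFamily_of_isSLELaw_six`) and its fat-germ one-shot surgery (the stmt-0698
  witness, re-assembled inline from its landed `stub_fatSurgery*` theorems) are two admissible
  non-tracing families that differ on an (admissibly discretised, `stub_discretisable`) Dobrushin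
  domain, while the guard-restricted conclusion would make both THE SLE₆ law there
  (`IsSLELaw.unique'`).  So ANY proof of the crux must USE clause (iv); the discretisability guard
  of the conclusion does not by itself keep the statement away from the refuted form.
* `eq_of_isSeqLimitAlong` — PINNING: two chordal families that are sequential limits of the ℤ²
  interfaces along the SAME mesh sequence coincide on every Dobrushin domain (every domain is
  admissibly discretised; finite Borel measures on the Polish space `CurveClass ℂ` are determined by
  bounded continuous integrals).  Hence `not_two_families_along_same_seq`: the two-family template
  that refuted stmt-0698 is dead along a common sequence — a competitor of the percolation limit is
  never itself a percolation limit along that sequence.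
* `forall_eq_of_symmetryUpgradeR` — a CONSEQUENCE of the crux: all admissible (LM + non-tracing)
  sequential limit families of the ℤ² interfaces, along possibly DIFFERENT mesh sequences, coincide.
  So the crux contains a uniqueness statement; a refutation channel is "two distinct admissible
  sequential limits" (an ultra-slow drift of the interface law in `log δ`, invisible to dilation
  invariance of limit points) — not constructible today, recorded for planners.
* `symmetryUpgradeR_iff_forall_domains` — normal form: the guard `ZdDiscretisationFamily D E →` of
  the conclusion and hypothesis (iii) are both removable (pure logic + the two theorems above).

Work file with the full analysis (refutation / vacuity channels, targets of the picked line):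
`Cruxes/SymmetryUpgradeR/Disproof.lean`.
-/

noncomputable section

open Set MeasureTheory Topology Filter Metric
open scoped unitInterval ENNReal NNReal

namespace Summit.CriticalPhenomena.CardyFormulaZ2.Theorems.SymmetryUpgradeR.Negative

open Literature.Probability.RandomPlanarGeometry Literature.Probability.LatticeModels
open Literature.Probability.Percolation
open Literature.Probability.RandomPlanarGeometry.ChordalFamily
open Summit.CriticalPhenomena.CardyFormulaZ2.Theses.CardySelfRefinement
open Summit.CriticalPhenomena.CardyFormulaZ2.Theorems.CardyRotToConfR2SymmetryUpgrade
open Summit.CriticalPhenomena.CardyFormulaZ2.Theorems.CardyRotToConfR2SymmetryUpgrade.Negative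
open Summit.CriticalPhenomena.CardyFormulaZ2.Cruxes.LagHandOff.HittingTournament (stub_discretisable)

/-! ### Clause (iii) is a theorem -/

/-- **Clause (iii) of `SymmetryUpgradeR` holds OUTRIGHT**: for every Dobrushin domain and every
admissible discretisation family the bond-ℤ² interface is (a.e.-)measurable at every positive mesh
(`LagHandOff.Negative.lagHandOff_clause_i`: the interface factors through the finitely many edges
of `Ω_δ`).  Hypothesis (iii) is therefore not load-bearing. [folklore] -/
theorem clauseIII_holds :
    ∀ (D : DobrushinDomain) (E : ℝ → DiscreteDobrushin), ZdDiscretisationFamily D E →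
      ∀ᶠ δ in nhdsWithin (0 : ℝ) (Set.Ioi 0),
        AEMeasurable (Interface.bondInterfaceIn D (E δ)) (bondPercolation (zdGraph 2) half) :=
  fun D E hE => LagHandOff.Negative.lagHandOff_clause_i D E hE

/-! ### Two admissible non-tracing families (the stmt-0698 witness, re-assembled) -/

/-- **Every family of chordal SLE₆ laws is a local Markov chordal family** — all five typed axioms
are theorems of the tree: chordality (`IsSLELaw.ae_endpoints`), conformal hence similarity
covariance, the typed domain Markov property (`isDomainMarkov_of_isSLELaw`), LSW locality
(`IsSLELaw.locality_six_holds`) and target independence from Lawler's Möbius form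
(`sle_six_moebius_locality_holds`).  So hypotheses (i)+(ii) of the crux are inhabited.
[cite: Werner2007, §3.2 and Prop 3.4] -/
theorem isLocalMarkovChordalFamily_of_isSLELaw_six {Q : ChordalFamily}
    (hQ : ∀ D : DobrushinDomain, IsSLELaw 6 D (Q D)) : IsLocalMarkovChordalFamily Q := by
  haveI : Fact Literature.Probability.Process.isProjectiveLimit_preWienerMeasure :=
    ⟨isProjectiveLimit_preWienerMeasure_holds⟩
  exact ⟨fun D => ⟨(hQ D).isProbabilityMeasure,
      (hQ D).ae_endpoints JordanDomain.mapsTo_boundaryExtension_holds⟩,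
    (ChordalFamily.isConformallyCovariant_of_isSLELaw hQ).isSimilarityCovariant,
    ChordalFamily.isDomainMarkov_of_isSLELaw (by norm_num) hQ,
    ChordalFamily.isLocal_of_isSLELaw_six IsSLELaw.locality_six_holds hQ,
    ChordalFamily.isTargetIndependent_of_isSLELaw_six_of_moebius sle_six_moebius_locality_holds hQ⟩

/-! ### Clause (iv) is load-bearing: without it the statement is false -/

/-- **`SymmetryUpgradeR` with clause (iv) deleted is FALSE** (everything else — the typed bundle,
no-tracing, the measurability hypothesis (iii) and the discretisability guard of the conclusion —
kept verbatim).  Witness: the SLE₆ family `Q` and its fat-germ surgery `J` are both admissible and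
non-tracing; on the domain `D` where they differ pick an admissible discretisation family
(`stub_discretisable`); the guarded conclusion makes `Q D` and `J D` SLE₆ laws of `(D; a, b)`, which
are unique (`IsSLELaw.unique'`).  Hence any proof of the crux must use (iv), and the guard alone
does not separate the crux from the refuted stmt-0698. [folklore] -/
theorem symmetryUpgradeR_false_without_clauseIV :
    ¬ (∀ P : ChordalFamily, IsLocalMarkovChordalFamily P →
        (∀ D : DobrushinDomain, ∀ᵐ γ ∂(P D), ∀ c : Curve ℂ, CurveClass.mk c = γ →
          ∀ s t : unitInterval, s < t → c '' Set.Icc s t ⊆ frontier D.carrier →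
            (c '' Set.Icc s t).Subsingleton) →
        (∀ (D : DobrushinDomain) (E : ℝ → DiscreteDobrushin), ZdDiscretisationFamily D E →
          ∀ᶠ δ in nhdsWithin (0 : ℝ) (Set.Ioi 0),
            AEMeasurable (Interface.bondInterfaceIn D (E δ)) (bondPercolation (zdGraph 2) half)) →
        ∀ (D : DobrushinDomain) (E : ℝ → DiscreteDobrushin), ZdDiscretisationFamily D E →
          IsSLELaw 6 D (P D)) := by
  intro h
  -- family one: chordal SLE₆ laws (Rohde–Schramm existence, `exists_isSLELaw_of_ne_eight`)
  obtain ⟨Q, hQ⟩ : ∃ Q : ChordalFamily, ∀ D : DobrushinDomain, IsSLELaw 6 D (Q D) :=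
    ⟨fun D => (exists_isSLELaw_of_ne_eight (κ := 6) (by norm_num) (by norm_num) D).choose,
      fun D => (exists_isSLELaw_of_ne_eight (κ := 6) (by norm_num) (by norm_num) D).choose_spec⟩
  have hadm : IsLocalMarkovChordalFamily Q := isLocalMarkovChordalFamily_of_isSLELaw_six hQ
  have hnt := stub_nonTracing Q hQ
  -- family two: the fat-germ one-shot surgery of `Q` (the stmt-0698 witness, from its landed stubs;
  -- this re-assembles `Theorems.exists_admissible_nonTracing_ne_of_isSLELaw_six`, whose module refers
  -- to the decl `SymmetryUpgrade` dropped from the route file at rev 12 and is not importable here)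
  have hseg : ∀ D : DobrushinDomain, ∀ᵐ γ ∂(Q D), ∀ c : Curve ℂ, CurveClass.mk c = γ →
      ∀ s t : unitInterval, s < t → Collinear ℝ (c '' Set.Icc s t) →
        (c '' Set.Icc s t).Subsingleton :=
    fun D => stub_sleSixNoTracedSegment D (Q D) (hQ D)
  have hnull : ∀ D : DobrushinDomain, ∀ᵐ γ ∂(Q D), volume γ.range = 0 :=
    fun D => stub_sleRangeNull D (Q D) (hQ D)
  have hend : ∀ D : DobrushinDomain, ∀ᵐ γ ∂(Q D), ∀ c : Curve ℂ, CurveClass.mk c = γ →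
      ∀ s t : unitInterval, s ≤ t → c s = D.pt 1 → c t = D.pt 1 :=
    fun D => stub_sleNoEarlyTarget D (Q D) (hQ D)
  have hJ : IsLocalMarkovChordalFamily (fatSurgery Q) :=
    ⟨(stub_fatSurgeryChordal Q hadm hnt).1, stub_fatSurgerySimilarity Q hadm,
      stub_fatSurgeryMarkovCore stub_tipSeparationGen stub_slitTrace Q hadm hnt hseg hnull hend,
      stub_fatSurgeryLocal Q hadm, stub_fatSurgeryTI Q hadm⟩
  have hJnt := (stub_fatSurgeryChordal Q hadm hnt).2
  -- they differ on the Osgood fat domain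
  obtain ⟨D, hfire, hq, hne⟩ :=
    stub_fatSurgeryWitness (stub_fatDomain Literature.Topology.PlaneTopology.exists_osgoodArc)
  obtain ⟨E, hE⟩ := stub_discretisable D
  have h₁ : IsSLELaw 6 D (fatSurgery Q D) := h (fatSurgery Q) hJ hJnt clauseIII_holds D E hE
  have h₂ : IsSLELaw 6 D (Q D) := h Q hadm hnt clauseIII_holds D E hE
  rw [fatSurgery_of_eq hfire hq] at h₁
  exact hne Q hseg (h₂.unique' h₁)

/-! ### Pinning: clause (iv) along a common sequence determines the family -/

/-- **Pinning lemma.**  Two chordal families whose laws on every Dobrushin domain are probability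
measures and which are sequential limits of the bond-ℤ² interfaces along the SAME mesh sequence
(convergence of `∫ f` for all bounded continuous `f`, every domain, every admissible family)
coincide: every domain is admissibly discretised (`stub_discretisable`), limits in `ℝ` are unique,
and finite Borel measures on the metric space `CurveClass ℂ` are determined by bounded continuous
integrals. [folklore] -/
theorem eq_of_isSeqLimitAlong {P₁ P₂ : ChordalFamily} (δs : ℕ → ℝ)
    (hp₁ : ∀ D : DobrushinDomain, IsProbabilityMeasure (P₁ D))
    (hp₂ : ∀ D : DobrushinDomain, IsProbabilityMeasure (P₂ D))
    (h₁ : ∀ (D : DobrushinDomain) (E : ℝ → DiscreteDobrushin), ZdDiscretisationFamily D E →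
      ∀ f : BoundedContinuousFunction (CurveClass ℂ) ℝ,
        Tendsto (fun n => ∫ ω, f (Interface.bondInterfaceIn D (E (δs n)) ω) ∂(bondPercolation (zdGraph 2) half))
          atTop (𝓝 (∫ γ, f γ ∂(P₁ D))))
    (h₂ : ∀ (D : DobrushinDomain) (E : ℝ → DiscreteDobrushin), ZdDiscretisationFamily D E →
      ∀ f : BoundedContinuousFunction (CurveClass ℂ) ℝ,
        Tendsto (fun n => ∫ ω, f (Interface.bondInterfaceIn D (E (δs n)) ω) ∂(bondPercolation (zdGraph 2) half))
          atTop (𝓝 (∫ γ, f γ ∂(P₂ D)))) :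
    P₁ = P₂ := by
  funext D
  obtain ⟨E, hE⟩ := stub_discretisable D
  haveI := hp₁ D
  haveI := hp₂ D
  exact ext_of_forall_integral_eq_of_IsFiniteMeasure fun f =>
    tendsto_nhds_unique (h₁ D E hE f) (h₂ D E hE f)

/-- **The two-family template is dead along a common sequence.**  Two local Markov chordal
families that both satisfy clause (iv) with the SAME mesh sequence are equal — so no competitor of
the percolation limit (surgery, germ rule, mixture) can be fed to the crux next to it. [folklore] -/
theorem not_two_families_along_same_seq {P₁ P₂ : ChordalFamily} (δs : ℕ → ℝ)
    (hP₁ : IsLocalMarkovChordalFamily P₁) (hP₂ : IsLocalMarkovChordalFamily P₂)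
    (h₁ : ∀ (D : DobrushinDomain) (E : ℝ → DiscreteDobrushin), ZdDiscretisationFamily D E →
      ∀ f : BoundedContinuousFunction (CurveClass ℂ) ℝ,
        Tendsto (fun n => ∫ ω, f (Interface.bondInterfaceIn D (E (δs n)) ω) ∂(bondPercolation (zdGraph 2) half))
          atTop (𝓝 (∫ γ, f γ ∂(P₁ D))))
    (h₂ : ∀ (D : DobrushinDomain) (E : ℝ → DiscreteDobrushin), ZdDiscretisationFamily D E →
      ∀ f : BoundedContinuousFunction (CurveClass ℂ) ℝ,
        Tendsto (fun n => ∫ ω, f (Interface.bondInterfaceIn D (E (δs n)) ω) ∂(bondPercolation (zdGraph 2) half))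
          atTop (𝓝 (∫ γ, f γ ∂(P₂ D))))
    (D : DobrushinDomain) : P₁ D = P₂ D := by
  rw [eq_of_isSeqLimitAlong δs (fun D => (hP₁.isChordal D).1) (fun D => (hP₂.isChordal D).1) h₁ h₂]

/-! ### Consequences of the crux: uniqueness of admissible sequential limits; normal form -/

/-- **The crux contains a uniqueness statement.**  Under `SymmetryUpgradeR`, any two families
satisfying its hypotheses — possibly along DIFFERENT mesh sequences — coincide on every Dobrushin
domain (both are THE SLE₆ law there).  A refutation channel, recorded not claimed: two distinct
admissible non-tracing sequential limits of the ℤ² interfaces (a drift of the interface law in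
`log δ` slower than any geometric sampling detects would produce them while every limit point stays
dilation invariant). [folklore] -/
theorem forall_eq_of_symmetryUpgradeR (h : SymmetryUpgradeR) {P₁ P₂ : ChordalFamily}
    (hP₁ : IsLocalMarkovChordalFamily P₁)
    (n₁ : ∀ D : DobrushinDomain, ∀ᵐ γ ∂(P₁ D), ∀ c : Curve ℂ, CurveClass.mk c = γ →
      ∀ s t : unitInterval, s < t → c '' Set.Icc s t ⊆ frontier D.carrier →
        (c '' Set.Icc s t).Subsingleton)
    (l₁ : ∃ δs : ℕ → ℝ, (∀ n, 0 < δs n) ∧ Tendsto δs atTop (𝓝 0) ∧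
      ∀ (D : DobrushinDomain) (E : ℝ → DiscreteDobrushin), ZdDiscretisationFamily D E →
        ∀ f : BoundedContinuousFunction (CurveClass ℂ) ℝ,
          Tendsto (fun n => ∫ ω, f (Interface.bondInterfaceIn D (E (δs n)) ω) ∂(bondPercolation (zdGraph 2) half))
            atTop (𝓝 (∫ γ, f γ ∂(P₁ D))))
    (hP₂ : IsLocalMarkovChordalFamily P₂)
    (n₂ : ∀ D : DobrushinDomain, ∀ᵐ γ ∂(P₂ D), ∀ c : Curve ℂ, CurveClass.mk c = γ →
      ∀ s t : unitInterval, s < t → c '' Set.Icc s t ⊆ frontier D.carrier →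
        (c '' Set.Icc s t).Subsingleton)
    (l₂ : ∃ δs : ℕ → ℝ, (∀ n, 0 < δs n) ∧ Tendsto δs atTop (𝓝 0) ∧
      ∀ (D : DobrushinDomain) (E : ℝ → DiscreteDobrushin), ZdDiscretisationFamily D E →
        ∀ f : BoundedContinuousFunction (CurveClass ℂ) ℝ,
          Tendsto (fun n => ∫ ω, f (Interface.bondInterfaceIn D (E (δs n)) ω) ∂(bondPercolation (zdGraph 2) half))
            atTop (𝓝 (∫ γ, f γ ∂(P₂ D))))
    (D : DobrushinDomain) : P₁ D = P₂ D := by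
  obtain ⟨E, hE⟩ := stub_discretisable D
  exact (h P₁ hP₁ n₁ clauseIII_holds l₁ D E hE).unique' (h P₂ hP₂ n₂ clauseIII_holds l₂ D E hE)

/-- **Normal form.**  `SymmetryUpgradeR` is equivalent to the same statement with hypothesis
(iii) removed (it is `clauseIII_holds`) and the conclusion asked on EVERY Dobrushin domain (every
domain is admissibly discretised, `stub_discretisable`):
`∀ P, IsLocalMarkovChordalFamily P → no-tracing → (iv) → ∀ D, IsSLELaw 6 D (P D)`. [folklore] -/
theorem symmetryUpgradeR_iff_forall_domains :
    SymmetryUpgradeR ↔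
      ∀ P : ChordalFamily, IsLocalMarkovChordalFamily P →
        (∀ D : DobrushinDomain, ∀ᵐ γ ∂(P D), ∀ c : Curve ℂ, CurveClass.mk c = γ →
          ∀ s t : unitInterval, s < t → c '' Set.Icc s t ⊆ frontier D.carrier →
            (c '' Set.Icc s t).Subsingleton) →
        (∃ δs : ℕ → ℝ, (∀ n, 0 < δs n) ∧ Tendsto δs atTop (𝓝 0) ∧
          ∀ (D : DobrushinDomain) (E : ℝ → DiscreteDobrushin), ZdDiscretisationFamily D E →
            ∀ f : BoundedContinuousFunction (CurveClass ℂ) ℝ,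
              Tendsto (fun n => ∫ ω, f (Interface.bondInterfaceIn D (E (δs n)) ω)
                ∂(bondPercolation (zdGraph 2) half)) atTop (𝓝 (∫ γ, f γ ∂(P D)))) →
        ∀ D : DobrushinDomain, IsSLELaw 6 D (P D) := by
  constructor
  · intro h P hP hnt hlim D
    obtain ⟨E, hE⟩ := stub_discretisable D
    exact h P hP hnt clauseIII_holds hlim D E hE
  · intro h P hP hnt _ hlim D E _
    exact h P hP hnt hlim D

end Summit.CriticalPhenomena.CardyFormulaZ2.Theorems.SymmetryUpgradeR.Negative

end
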